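import Literature.NumberTheory.EllipticCurves.BinaryQuarticRealOrbitsProofs
import HarnessLib

/-!
# Real orbits of binary quartic forms, II: transitivity — forms of the same real type with the
# same invariants `I`, `J` are `SL₂^{±}(ℝ)`-equivalent (Bhargava–Shankar, §2.1, facts 1–2)

`Proofs` companion of `BinaryQuarticForms.lean` (theorems only: no definitions, no named facts),
completing `BinaryQuarticRealOrbitsProofs.lean`. Bhargava–Shankar (*Binary quartic forms having
bounded invariants, and the boundedness of the average rank of elliptic curves*, Ann. of Math. (2)
181 (2015) 191–242), §2.1: "1. The set of binary quartic forms in `V_ℝ` having fixed invariants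
`I` and `J` consists of just one [`SL₂^{±}(ℝ)`-]orbit if `4I³ − J² < 0`; this orbit lies in
`V_ℝ^{(1)}`. 2. The set of binary quartic forms in `V_ℝ` having fixed invariants `I` and `J`
consists of three orbits if `4I³ − J² > 0`; in that case, there is one such orbit from each of
`V_ℝ^{(0)}`, `V_ℝ^{(2+)}`, and `V_ℝ^{(2−)}`" (the group being `SL₂^{±}(ℝ) = {det = ±1}`, for whose
action `I`, `J` are the invariants, §2 p. 8).

## Contents (all proved)

* `exists_subst_eq_of_eval_eq_zero_of_invariants_eq`: two real forms with `Δ ≠ 0`, a real zero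
  each, and the same `(I, J)` are `SL₂^{±}(ℝ)`-equivalent (both are equivalent to `q_{I,J}`,
  `BinaryQuarticRealOrbitsProofs`): the single orbit in `V_ℝ^{(1)}` (fact 1) and in `V_ℝ^{(0)}`
  (fact 2).
* `circleForm_subst_rotation`, `exists_rotation_diagonalise`: a rotation `k ∈ SO₂(ℝ)` takes
  `(x² + y²)(Px² + Qxy + Ry²)` to a *diagonal* form `(x² + y²)(P'x² + R'y²) = ⟨P', 0, P'+R', 0, R'⟩`.
* `diag_params_eq`: the invariants `I = σ² + 12π`, `J = 72πσ − 2σ³` (`σ = P + R`, `π = PR`) of a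
  diagonal form with `P, R > 0` determine `σ` and `π` (on the admissible range `4π ≤ σ²`,
  `J = 6Iσ − 8σ³` is strictly decreasing in `σ`).
* `exists_subst_eq_of_posDef_of_invariants_eq`: **two positive definite real forms with the same
  `(I, J)` are `SL₂(ℝ)`-equivalent** — the single orbit "from `V_ℝ^{(2+)}`" of fact 2 — and likewise
  for negative definite forms (`exists_subst_eq_of_negDef_of_invariants_eq`).

## References

* M. Bhargava, A. Shankar, Ann. of Math. (2) 181 (2015) 191–242 = arXiv:1006.1002, §2.1, facts
  1–2 (there attributed to [cremred] = J. E. Cremona, *Reduction of binary cubic and quartic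
  forms*, LMS J. Comput. Math. 2 (1999)). [cite: BhargavaShankarAnnals2015, §2.1 (facts 1–2; arXiv:1006.1002v2 numbering)]
-/

noncomputable section

open scoped Classical
open Polynomial

namespace Literature.NumberTheory.EllipticCurves

namespace BinaryQuartic

/-! ## §1 Types `0` and `1`: both forms are equivalent to `q_{I,J}` -/

/-- **Facts 1–2 for forms with a real zero**: two real forms with nonzero discriminant, a zero in
`ℙ¹(ℝ)` each (i.e. in `V_ℝ^{(0)} ∪ V_ℝ^{(1)}`) and the same invariants `(I, J)` are
`SL₂^{±}(ℝ)`-equivalent: `f₂ = γ · f₁`, `det γ = ±1` (both are equivalent to `q_{I,J}`,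
`exists_subst_eq_qForm_of_eval_eq_zero`). Since `Δ = (4I³ − J²)/27` is then common, this is the
single orbit in `V_ℝ^{(1)}` (`Δ < 0`) of fact 1 and the single orbit from `V_ℝ^{(0)}` of fact 2.
[cite: BhargavaShankarAnnals2015, §2.1 (facts 1–2)] -/
theorem exists_subst_eq_of_eval_eq_zero_of_invariants_eq {f₁ f₂ : BinaryQuartic ℝ}
    (hΔ₁ : f₁.disc ≠ 0) (hΔ₂ : f₂.disc ≠ 0)
    (hz₁ : ∃ x y : ℝ, (x ≠ 0 ∨ y ≠ 0) ∧ f₁.eval x y = 0)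
    (hz₂ : ∃ x y : ℝ, (x ≠ 0 ∨ y ≠ 0) ∧ f₂.eval x y = 0) (hI : f₁.I = f₂.I) (hJ : f₁.J = f₂.J) :
    ∃ γ : Matrix (Fin 2) (Fin 2) ℝ, (γ.det = 1 ∨ γ.det = -1) ∧ f₂ = f₁.subst γ := by
  obtain ⟨γ₁, hγ₁, h₁⟩ := exists_subst_eq_qForm_of_eval_eq_zero hΔ₁ hz₁
  obtain ⟨γ₂, hγ₂, h₂⟩ := exists_subst_eq_qForm_of_eval_eq_zero hΔ₂ hz₂
  rw [hI, hJ, ← h₂] at h₁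
  -- `γ₁ · f₁ = γ₂ · f₂`, so `f₂ = γ₂⁻¹ γ₁ · f₁`
  have hγ₂0 : γ₂.det ≠ 0 := by rcases hγ₂ with h | h <;> rw [h] <;> norm_num
  have hγ₂u : IsUnit γ₂.det := isUnit_iff_ne_zero.mpr hγ₂0
  refine ⟨γ₂⁻¹ * γ₁, ?_, ?_⟩
  · rw [Matrix.det_mul, Matrix.det_nonsing_inv, Ring.inverse_eq_inv']
    rcases hγ₁ with h | h <;> rcases hγ₂ with h' | h' <;> simp [h, h']
  · rw [subst_mul, h₁, ← subst_mul, Matrix.nonsing_inv_mul γ₂ hγ₂u, subst_one]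

/-- The same for forms of negative discriminant (`V_ℝ^{(1)}`): **fact 1**, one orbit.
[cite: BhargavaShankarAnnals2015, §2.1 (fact 1)] -/
theorem exists_subst_eq_of_disc_neg_of_invariants_eq {f₁ f₂ : BinaryQuartic ℝ}
    (hΔ₁ : f₁.disc < 0) (hΔ₂ : f₂.disc < 0) (hI : f₁.I = f₂.I) (hJ : f₁.J = f₂.J) :
    ∃ γ : Matrix (Fin 2) (Fin 2) ℝ, (γ.det = 1 ∨ γ.det = -1) ∧ f₂ = f₁.subst γ :=
  exists_subst_eq_of_eval_eq_zero_of_invariants_eq hΔ₁.ne hΔ₂.ne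
    (exists_eval_eq_zero_of_disc_neg f₁ hΔ₁) (exists_eval_eq_zero_of_disc_neg f₂ hΔ₂) hI hJ

/-- The same for indefinite forms of nonzero (hence positive) discriminant (`V_ℝ^{(0)}`): the orbit
from `V_ℝ^{(0)}` of **fact 2**. [cite: BhargavaShankarAnnals2015, §2.1 (fact 2)] -/
theorem exists_subst_eq_of_not_isDefinite_of_invariants_eq {f₁ f₂ : BinaryQuartic ℝ}
    (hΔ₁ : f₁.disc ≠ 0) (hΔ₂ : f₂.disc ≠ 0) (hd₁ : ¬ f₁.IsDefinite) (hd₂ : ¬ f₂.IsDefinite)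
    (hI : f₁.I = f₂.I) (hJ : f₁.J = f₂.J) :
    ∃ γ : Matrix (Fin 2) (Fin 2) ℝ, (γ.det = 1 ∨ γ.det = -1) ∧ f₂ = f₁.subst γ :=
  exists_subst_eq_of_eval_eq_zero_of_invariants_eq hΔ₁ hΔ₂
    ((not_isDefinite_iff_exists_eval_eq_zero f₁).mp hd₁)
    ((not_isDefinite_iff_exists_eval_eq_zero f₂).mp hd₂) hI hJ

/-! ## §2 Definite forms: diagonalisation by a rotation -/

/-- **A rotation acting on `(x² + y²)(Px² + Qxy + Ry²)`**: for `c² + s² = 1`,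
`k = (c s; −s c)` fixes `x² + y²` and transforms the quadratic factor, giving
`⟨P', Q', P' + R', Q', R'⟩` with `P' = Pc² + Qcs + Rs²`, `R' = Ps² − Qcs + Rc²`,
`Q' = 2(R − P)cs + Q(c² − s²)`. [folklore] -/
theorem circleForm_subst_rotation (P Q R : ℝ) {c s : ℝ} (h : c ^ 2 + s ^ 2 = 1) :
    (⟨P, Q, P + R, Q, R⟩ : BinaryQuartic ℝ).subst !![c, s; -s, c] =
      ⟨P * c ^ 2 + Q * c * s + R * s ^ 2, 2 * (R - P) * c * s + Q * (c ^ 2 - s ^ 2),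
        (P * c ^ 2 + Q * c * s + R * s ^ 2) + (P * s ^ 2 - Q * c * s + R * c ^ 2),
        2 * (R - P) * c * s + Q * (c ^ 2 - s ^ 2), P * s ^ 2 - Q * c * s + R * c ^ 2⟩ := by
  ext <;> simp [subst]
  · linear_combination (P * c ^ 2 + Q * c * s + R * s ^ 2) * h
  · linear_combination (2 * (R - P) * c * s + Q * (c ^ 2 - s ^ 2)) * h
  · linear_combination ((P + R) * (c ^ 2 + s ^ 2)) * h
  · linear_combination (2 * (R - P) * c * s + Q * (c ^ 2 - s ^ 2)) * h
  · linear_combination (P * s ^ 2 - Q * c * s + R * c ^ 2) * h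

/-- **Existence of a diagonalising rotation**: for all real `P, Q, R` there are `c, s` with
`c² + s² = 1` and `2(R − P)cs + Q(c² − s²) = 0` (take `(cos 2θ, sin 2θ) ∥ (P − R, Q)` and
half angles: `c² = (1 + cos 2θ)/2`, `s² = (1 − cos 2θ)/2`, `2cs = sin 2θ`). [folklore] -/
theorem exists_rotation_diagonalise (P Q R : ℝ) :
    ∃ c s : ℝ, c ^ 2 + s ^ 2 = 1 ∧ 2 * (R - P) * c * s + Q * (c ^ 2 - s ^ 2) = 0 := by
  by_cases hQ : Q = 0
  · exact ⟨1, 0, by norm_num, by rw [hQ]; ring⟩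
  set A : ℝ := P - R with hA
  set ρ : ℝ := Real.sqrt (A ^ 2 + Q ^ 2) with hρ
  have hρpos : 0 < ρ := Real.sqrt_pos.mpr (by positivity)
  have hρsq : ρ ^ 2 = A ^ 2 + Q ^ 2 := Real.sq_sqrt (by positivity)
  set C2 : ℝ := A / ρ with hC2
  set S2 : ℝ := Q / ρ with hS2
  have hCS : C2 ^ 2 + S2 ^ 2 = 1 := by
    rw [hC2, hS2, div_pow, div_pow, ← add_div, ← hρsq, div_self (pow_ne_zero 2 hρpos.ne')]
  have hC2le : C2 ≤ 1 := by nlinarith [sq_nonneg S2]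
  have hC2ge : -1 ≤ C2 := by nlinarith [sq_nonneg S2]
  -- the sign of `S2`
  obtain ⟨σ, hσsq, hσS⟩ : ∃ σ : ℝ, σ ^ 2 = 1 ∧ σ * |S2| = S2 := by
    rcases le_or_gt 0 S2 with h | h
    · exact ⟨1, by norm_num, by rw [abs_of_nonneg h, one_mul]⟩
    · exact ⟨-1, by norm_num, by rw [abs_of_neg h]; ring⟩
  set c : ℝ := Real.sqrt ((1 + C2) / 2) with hc
  set s : ℝ := σ * Real.sqrt ((1 - C2) / 2) with hs
  have hc2 : c ^ 2 = (1 + C2) / 2 := Real.sq_sqrt (by linarith)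
  have hs2 : s ^ 2 = (1 - C2) / 2 := by
    rw [hs, mul_pow, hσsq, one_mul]; exact Real.sq_sqrt (by linarith)
  have hcs : 2 * c * s = S2 := by
    have : c * Real.sqrt ((1 - C2) / 2) = |S2| / 2 := by
      rw [hc, ← Real.sqrt_mul (by linarith)]
      have e : (1 + C2) / 2 * ((1 - C2) / 2) = (S2 / 2) ^ 2 := by nlinarith [hCS]
      rw [e, Real.sqrt_sq_eq_abs, abs_div, abs_of_pos (by norm_num : (0 : ℝ) < 2)]
    calc 2 * c * s = 2 * σ * (c * Real.sqrt ((1 - C2) / 2)) := by rw [hs]; ring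
      _ = σ * |S2| := by rw [this]; ring
      _ = S2 := hσS
  refine ⟨c, s, by rw [hc2, hs2]; ring, ?_⟩
  have e1 : 2 * (R - P) * c * s = -A * S2 := by rw [← hcs, hA]; ring
  rw [e1, hc2, hs2, hC2, hS2]
  field_simp
  ring

/-- **Diagonalisation**: a circle form `(x² + y²)(Px² + Qxy + Ry²)` with `P > 0`, `Q² < 4PR`
(so `R > 0`) is taken by a rotation (determinant `1`) to a diagonal form `⟨P', 0, P' + R', 0, R'⟩`
with `P', R' > 0`. [folklore] -/
theorem exists_rotation_subst_eq_diag {P Q R : ℝ} (hP : 0 < P) (hQ : Q ^ 2 < 4 * P * R) :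
    ∃ k : Matrix (Fin 2) (Fin 2) ℝ, k.det = 1 ∧ ∃ P' R' : ℝ, 0 < P' ∧ 0 < R' ∧
      (⟨P, Q, P + R, Q, R⟩ : BinaryQuartic ℝ).subst k = ⟨P', 0, P' + R', 0, R'⟩ := by
  obtain ⟨c, s, hcs, hdiag⟩ := exists_rotation_diagonalise P Q R
  refine ⟨!![c, s; -s, c], by rw [Matrix.det_fin_two_of]; linear_combination hcs,
    P * c ^ 2 + Q * c * s + R * s ^ 2, P * s ^ 2 - Q * c * s + R * c ^ 2, ?_, ?_, ?_⟩
  · have hne : c ≠ 0 ∨ s ≠ 0 := by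
      by_contra h0; push Not at h0; rw [h0.1, h0.2] at hcs; norm_num at hcs
    have := quadratic_pos hP (by linarith : Q ^ 2 - 4 * P * R < 0) hne
    linarith [this]
  · have hne : -s ≠ 0 ∨ c ≠ 0 := by
      by_contra h0; push Not at h0
      rw [h0.2, neg_eq_zero.mp h0.1] at hcs; norm_num at hcs
    have := quadratic_pos hP (by linarith : Q ^ 2 - 4 * P * R < 0) hne
    linarith [this]
  · rw [circleForm_subst_rotation P Q R hcs, hdiag]

/-! ## §3 The invariants of a diagonal form determine it up to the swap `P ↔ R` -/

/-- `I` of the diagonal form `(x² + y²)(Px² + Ry²)`: `σ² + 12π`, `σ = P + R`, `π = PR`. [folklore] -/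
theorem I_diagForm (P R : ℝ) :
    (⟨P, 0, P + R, 0, R⟩ : BinaryQuartic ℝ).I = (P + R) ^ 2 + 12 * (P * R) := by
  simp only [I]; ring

/-- `J` of the diagonal form `(x² + y²)(Px² + Ry²)`: `72πσ − 2σ³`. [folklore] -/
theorem J_diagForm (P R : ℝ) :
    (⟨P, 0, P + R, 0, R⟩ : BinaryQuartic ℝ).J = 72 * (P * R) * (P + R) - 2 * (P + R) ^ 3 := by
  simp only [J]; ring

/-- **The invariants determine `σ = P + R` and `π = PR`** for diagonal forms with `P, R > 0`:
writing `I = σ² + 12π`, one has `J = 6Iσ − 8σ³`, strictly decreasing in `σ` on the admissible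
range `4π ≤ σ²` (i.e. `σ² ≥ I/4`), so equal `(I, J)` forces equal `σ`, then equal `π`. [folklore] -/
theorem diag_params_eq {P₁ R₁ P₂ R₂ : ℝ} (hP₁ : 0 < P₁) (hR₁ : 0 < R₁) (hP₂ : 0 < P₂)
    (hR₂ : 0 < R₂)
    (hI : (P₁ + R₁) ^ 2 + 12 * (P₁ * R₁) = (P₂ + R₂) ^ 2 + 12 * (P₂ * R₂))
    (hJ : 72 * (P₁ * R₁) * (P₁ + R₁) - 2 * (P₁ + R₁) ^ 3 =
      72 * (P₂ * R₂) * (P₂ + R₂) - 2 * (P₂ + R₂) ^ 3) :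
    P₁ + R₁ = P₂ + R₂ ∧ P₁ * R₁ = P₂ * R₂ := by
  set σ₁ := P₁ + R₁ with hσ₁
  set σ₂ := P₂ + R₂ with hσ₂
  set π₁ := P₁ * R₁ with hπ₁
  set π₂ := P₂ * R₂ with hπ₂
  have hσ₁pos : 0 < σ₁ := by rw [hσ₁]; positivity
  have hσ₂pos : 0 < σ₂ := by rw [hσ₂]; positivity
  have hπσ₁ : 4 * π₁ ≤ σ₁ ^ 2 := by rw [hπ₁, hσ₁]; nlinarith [sq_nonneg (P₁ - R₁)]
  have hπσ₂ : 4 * π₂ ≤ σ₂ ^ 2 := by rw [hπ₂, hσ₂]; nlinarith [sq_nonneg (P₂ - R₂)]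
  -- `J = 6 I σ − 8 σ³` with the common `I`
  have key : (σ₁ - σ₂) * (6 * (σ₁ ^ 2 + 12 * π₁) - 8 * (σ₁ ^ 2 + σ₁ * σ₂ + σ₂ ^ 2)) = 0 := by
    linear_combination hJ - (6 * σ₂) * hI
  have hσ : σ₁ = σ₂ := by
    rcases mul_eq_zero.mp key with h | h
    · linarith
    · by_contra hne
      rcases lt_or_gt_of_ne hne with hlt | hgt
      · -- `σ₁ < σ₂`: `6I ≤ 24σ₁² < 8(σ₁² + σ₁σ₂ + σ₂²) = 6I`
        nlinarith [mul_pos hσ₁pos (sub_pos.mpr hlt), mul_pos (sub_pos.mpr hlt) (sub_pos.mpr hlt)]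
      · -- `σ₂ < σ₁`: use `I = σ₂² + 12π₂ ≤ 4σ₂²`
        have h' : 6 * (σ₂ ^ 2 + 12 * π₂) - 8 * (σ₁ ^ 2 + σ₁ * σ₂ + σ₂ ^ 2) = 0 := by
          linear_combination h - 6 * hI
        nlinarith [mul_pos hσ₂pos (sub_pos.mpr hgt), mul_pos (sub_pos.mpr hgt) (sub_pos.mpr hgt)]
  refine ⟨hσ, ?_⟩
  have : 12 * π₁ = 12 * π₂ := by
    have := hI; rw [hσ] at this; linarith
  linarith

/-- The swap `(x, y) ↦ (−y, x)` (determinant `1`) exchanges `P` and `R` in a diagonal form. [folklore] -/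
theorem diagForm_subst_swap (P R : ℝ) :
    (⟨P, 0, P + R, 0, R⟩ : BinaryQuartic ℝ).subst !![0, 1; -1, 0] = ⟨R, 0, R + P, 0, P⟩ := by
  ext <;> simp [subst] <;> ring

/-! ## §4 The single orbits from `V_ℝ^{(2+)}` and `V_ℝ^{(2−)}` -/

/-- A positive definite real form is `SL₂(ℝ)`-equivalent to a diagonal form `(x² + y²)(P'x² + R'y²)`,
`P', R' > 0` (`exists_subst_eq_circleForm_of_posDef` followed by a diagonalising rotation). [folklore] -/
theorem exists_subst_eq_diag_of_posDef {f : BinaryQuartic ℝ}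
    (hpos : ∀ x y : ℝ, (x ≠ 0 ∨ y ≠ 0) → 0 < f.eval x y) :
    ∃ M : Matrix (Fin 2) (Fin 2) ℝ, M.det = 1 ∧ ∃ P' R' : ℝ, 0 < P' ∧ 0 < R' ∧
      f.subst M = ⟨P', 0, P' + R', 0, R'⟩ := by
  obtain ⟨γ, hγ, P, Q, R, hf, hP, hR, hQ⟩ := exists_subst_eq_circleForm_of_posDef hpos
  obtain ⟨k, hk, P', R', hP', hR', hdiag⟩ := exists_rotation_subst_eq_diag hP hQ
  refine ⟨k * γ, by rw [Matrix.det_mul, hk, hγ, one_mul], P', R', hP', hR', ?_⟩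
  rw [subst_mul, hf, hdiag]

/-- **Fact 2, the orbit from `V_ℝ^{(2+)}`: two positive definite real binary quartic forms with the
same invariants `(I, J)` are `SL₂(ℝ)`-equivalent** (`f₂ = γ · f₁`, `det γ = 1`). Both are
equivalent to diagonal forms `(x² + y²)(Pᵢx² + Rᵢy²)`; equal invariants force
`{P₁, R₁} = {P₂, R₂}` (`diag_params_eq`), and `P ↔ R` is realised by the rotation `(x,y) ↦ (−y,x)`.
[cite: BhargavaShankarAnnals2015, §2.1 (fact 2, V_ℝ^{(2+)})] -/
theorem exists_subst_eq_of_posDef_of_invariants_eq {f₁ f₂ : BinaryQuartic ℝ}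
    (h₁ : ∀ x y : ℝ, (x ≠ 0 ∨ y ≠ 0) → 0 < f₁.eval x y)
    (h₂ : ∀ x y : ℝ, (x ≠ 0 ∨ y ≠ 0) → 0 < f₂.eval x y) (hI : f₁.I = f₂.I) (hJ : f₁.J = f₂.J) :
    ∃ γ : Matrix (Fin 2) (Fin 2) ℝ, γ.det = 1 ∧ f₂ = f₁.subst γ := by
  obtain ⟨M₁, hM₁, P₁, R₁, hP₁, hR₁, hD₁⟩ := exists_subst_eq_diag_of_posDef h₁
  obtain ⟨M₂, hM₂, P₂, R₂, hP₂, hR₂, hD₂⟩ := exists_subst_eq_diag_of_posDef h₂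
  -- the diagonal forms have the invariants of `f₁`, `f₂`
  have hI' : (P₁ + R₁) ^ 2 + 12 * (P₁ * R₁) = (P₂ + R₂) ^ 2 + 12 * (P₂ * R₂) := by
    rw [← I_diagForm, ← I_diagForm, ← hD₁, ← hD₂, I_subst, I_subst, hM₁, hM₂, hI]
  have hJ' : 72 * (P₁ * R₁) * (P₁ + R₁) - 2 * (P₁ + R₁) ^ 3 =
      72 * (P₂ * R₂) * (P₂ + R₂) - 2 * (P₂ + R₂) ^ 3 := by
    rw [← J_diagForm, ← J_diagForm, ← hD₁, ← hD₂, J_subst, J_subst, hM₁, hM₂, hJ]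
  obtain ⟨hσ, hπ⟩ := diag_params_eq hP₁ hR₁ hP₂ hR₂ hI' hJ'
  -- so `P₂ ∈ {P₁, R₁}`
  have hroot : (P₂ - P₁) * (P₂ - R₁) = 0 := by
    have : R₂ = P₁ + R₁ - P₂ := by linarith
    rw [this] at hπ
    linear_combination hπ
  have hM₂u : IsUnit M₂.det := by rw [hM₂]; exact isUnit_one
  have hinv : (M₂⁻¹).det = 1 := by
    rw [Matrix.det_nonsing_inv, Ring.inverse_eq_inv', hM₂, inv_one]
  have hf₂ : f₂ = (⟨P₂, 0, P₂ + R₂, 0, R₂⟩ : BinaryQuartic ℝ).subst M₂⁻¹ := by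
    rw [← hD₂, ← subst_mul, Matrix.nonsing_inv_mul M₂ hM₂u, subst_one]
  rcases mul_eq_zero.mp hroot with h | h
  · -- `P₂ = P₁`, `R₂ = R₁`: the diagonal forms coincide
    have hP : P₂ = P₁ := by linarith
    have hR : R₂ = R₁ := by linarith
    refine ⟨M₂⁻¹ * M₁, by rw [Matrix.det_mul, hinv, hM₁, one_mul], ?_⟩
    rw [subst_mul, hD₁, hf₂, hP, hR]
  · -- `P₂ = R₁`, `R₂ = P₁`: swap
    have hP : P₂ = R₁ := by linarith
    have hR : R₂ = P₁ := by linarith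
    refine ⟨M₂⁻¹ * !![0, 1; -1, 0] * M₁, ?_, ?_⟩
    · rw [Matrix.det_mul, Matrix.det_mul, hinv, hM₁, Matrix.det_fin_two_of]; norm_num
    · rw [subst_mul, subst_mul, hD₁, diagForm_subst_swap, hf₂, hP, hR]

/-- **Fact 2, the orbit from `V_ℝ^{(2−)}`**: two negative definite real forms with the same
`(I, J)` are `SL₂(ℝ)`-equivalent (apply the positive definite case to `−f₁`, `−f₂`).
[cite: BhargavaShankarAnnals2015, §2.1 (fact 2, V_ℝ^{(2−)})] -/
theorem exists_subst_eq_of_negDef_of_invariants_eq {f₁ f₂ : BinaryQuartic ℝ}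
    (h₁ : ∀ x y : ℝ, (x ≠ 0 ∨ y ≠ 0) → f₁.eval x y < 0)
    (h₂ : ∀ x y : ℝ, (x ≠ 0 ∨ y ≠ 0) → f₂.eval x y < 0) (hI : f₁.I = f₂.I) (hJ : f₁.J = f₂.J) :
    ∃ γ : Matrix (Fin 2) (Fin 2) ℝ, γ.det = 1 ∧ f₂ = f₁.subst γ := by
  have h₁' : ∀ x y : ℝ, (x ≠ 0 ∨ y ≠ 0) → 0 < ((-1 : ℝ) • f₁).eval x y := fun x y hxy ↦ by
    rw [eval_smul]; have := h₁ x y hxy; linarith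
  have h₂' : ∀ x y : ℝ, (x ≠ 0 ∨ y ≠ 0) → 0 < ((-1 : ℝ) • f₂).eval x y := fun x y hxy ↦ by
    rw [eval_smul]; have := h₂ x y hxy; linarith
  obtain ⟨γ, hγ, h⟩ := exists_subst_eq_of_posDef_of_invariants_eq h₁' h₂'
    (by rw [I_smul, I_smul, hI]) (by rw [J_smul, J_smul, hJ])
  refine ⟨γ, hγ, ?_⟩
  have := congrArg (fun g : BinaryQuartic ℝ ↦ (-1 : ℝ) • g) h
  simpa only [smul_subst, smul_smul, show (-1 : ℝ) * -1 = 1 by norm_num, one_smul] using this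

/-- **Facts 1–2, summary for definite forms**: two definite real forms of the same sign with the
same `(I, J)` are `SL₂(ℝ)`-equivalent; forms of opposite signs, or a definite and an indefinite
form, are never `GL₂(ℝ)`-equivalent (`isDefinite_subst_iff`, `posDef_subst_iff` in
`BinaryQuarticFormsProofs` / `BinaryQuarticRealTypesProofs`), so for `4I³ − J² > 0` the real forms
with invariants `(I, J)` form exactly the three orbits `V_ℝ^{(0)}`, `V_ℝ^{(2+)}`, `V_ℝ^{(2−)}`.
Here: the positive and the negative definite orbits are distinct. [cite: BhargavaShankarAnnals2015, §2.1 (fact 2)] -/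
theorem not_subst_eq_of_posDef_of_negDef {f₁ f₂ : BinaryQuartic ℝ}
    (h₁ : ∀ x y : ℝ, (x ≠ 0 ∨ y ≠ 0) → 0 < f₁.eval x y)
    (h₂ : ∀ x y : ℝ, (x ≠ 0 ∨ y ≠ 0) → f₂.eval x y < 0) {γ : Matrix (Fin 2) (Fin 2) ℝ}
    (hγ : γ.det ≠ 0) : f₂ ≠ f₁.subst γ := by
  intro h
  have := (posDef_subst_iff f₁ hγ).mpr h₁ 1 0 (Or.inl one_ne_zero)
  rw [← h] at this
  linarith [h₂ 1 0 (Or.inl one_ne_zero)]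

end BinaryQuartic

end Literature.NumberTheory.EllipticCurves

end
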